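import Summits.Ventures.CertifiedArithmetic.LowPrec.Representable
import Literature.ComputerArithmetic.JeannerodRump2018.Summation

/-!
# Bridge: the values of a minifloat format are exactly the Jeannerod–Rump floats in range

HONEST FRAMING (venture CertifiedArithmetic / cell `pub-lowprec`): certified error envelopes and
provably optimal rounding/accumulation schemes for low-precision formats under stated cost models;
every table by two implementations; no hardware or vendor claims.

`Literature/ComputerArithmetic/JeannerodRump2018/Summation.lean` types the paper's number system
`F = {M·2^e : |M| < 2^p, e ≥ emin}` (`IsFloat p emin`). For a `Format φ` (precision `p = m+1`,
`emin`-quantum exponent `qexp`): every finite datum's value is such a float (`isFloat_toRat`), and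
conversely every such float of magnitude `≤ maxRat φ` is the value of a datum
(`exists_toRat_eq_of_isFloat`). Hence the cited any-order summation facts (`theorem41`,
`sumError_le`) speak about exactly the values this venture computes with, as long as no overflow
occurs; instantiating them additionally needs a round-to-nearest map on all of `ℚ` extending
`roundNE φ` beyond `maxRat` (not constructed here).
-/

namespace Literature.ComputerArithmetic.FloatingPoint

namespace MiniFloat

open Literature.ComputerArithmetic.JeannerodRump2018

variable {φ : Format}

/-- Every value of `φ` is a binary float of precision `m+1` with exponent `≥ qexp φ`.
[folklore] -/
theorem isFloat_toRat (x : MiniFloat φ) : IsFloat (φ.manBits + 1) φ.qexp x.toRat := by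
  obtain ⟨-, k, j, hk, hkj⟩ := representable_iff.mp x.representable_scaledMag
  refine ⟨if x.neg then -(k : ℤ) else k, φ.qexp + j, ?_, by omega, ?_⟩
  · have : (k : ℤ) < 2 ^ (φ.manBits + 1) := by exact_mod_cast hk
    split <;> simp [abs_of_nonneg, this]
  · unfold toRat toInt Format.quantum
    rw [hkj, zpow_add₀ (by norm_num : (2 : ℚ) ≠ 0), zpow_natCast]
    cases x.neg <;> simp <;> ring

/-- Conversely, a binary float of precision `m+1`, exponent `≥ qexp φ` and magnitude `≤ maxRat φ`
is the value of a datum of `φ`. [folklore] -/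
theorem exists_toRat_eq_of_isFloat {v : ℚ} (h : IsFloat (φ.manBits + 1) φ.qexp v)
    (hv : |v| ≤ φ.maxRat) : ∃ x : MiniFloat φ, x.toRat = v := by
  obtain ⟨M, e, hM, he, rfl⟩ := h
  obtain ⟨j, hj⟩ := Int.eq_ofNat_of_zero_le (sub_nonneg.mpr he)
  have h2 : (2 : ℚ) ≠ 0 := by norm_num
  have hq := φ.quantum_pos
  -- magnitude in quanta: |M| · 2^j
  have hval : (M : ℚ) * (2 : ℚ) ^ e = ((M : ℚ) * 2 ^ j) * φ.quantum := by
    unfold Format.quantum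
    rw [show e = φ.qexp + (j : ℤ) by omega, zpow_add₀ h2, zpow_natCast]; ring
  have hkM : M.natAbs < 2 ^ (φ.manBits + 1) := by
    have : (M.natAbs : ℤ) < 2 ^ (φ.manBits + 1) := by rw [Int.natCast_natAbs]; exact_mod_cast hM
    exact_mod_cast this
  have hnat : ((M.natAbs : ℕ) : ℚ) = |(M : ℚ)| := by rw [Nat.cast_natAbs, Int.cast_abs]
  have hle : M.natAbs * 2 ^ j ≤ φ.maxScaled := by
    have h1 : |(M : ℚ) * (2 : ℚ) ^ e| = (M.natAbs * 2 ^ j : ℕ) * φ.quantum := by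
      rw [hval, abs_mul, abs_mul, abs_of_pos hq, abs_of_nonneg (by positivity : (0:ℚ) ≤ 2 ^ j)]
      push_cast; rw [hnat]
    rw [h1] at hv
    unfold Format.maxRat at hv
    exact_mod_cast le_of_mul_le_mul_right hv hq
  have hrep : φ.Representable (M.natAbs * 2 ^ j) := representable_mul_pow hkM hle
  refine ⟨ofScaled φ (decide (M < 0)) _ hle, ?_⟩
  rw [toRat_ofScaled hle hrep, hval]
  congr 1
  push_cast
  by_cases hM0 : M < 0
  · have hM0' : (M : ℚ) < 0 := by exact_mod_cast hM0
    rw [if_pos (by simpa using hM0), hnat, abs_of_neg hM0']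
    ring
  · have hM0' : (0 : ℚ) ≤ M := by exact_mod_cast not_lt.mp hM0
    rw [if_neg (by simpa using hM0), hnat, abs_of_nonneg hM0']

end MiniFloat

end Literature.ComputerArithmetic.FloatingPoint
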